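import Summits.MatrixMultiplication.MatrixMultiplication.Theorems.ThresholdSubsetTriples.Negative.Packing
import Literature.Barriers.MatrixMultiplication.YoungSubgroupBarrierProofs
import Literature.Barriers.MatrixMultiplication.NilpotentGroupBarrierSemisimple

/-!
# `ThresholdSubsetTriples` (crux stmt-MatrixMultiplication-10882) — negative-side support II:
# the Young strengthening is false; conditional disproofs and where they cannot come from

* §2 `not_thresholdYoungTriples`: `X` restricted to triples of Young subgroups is FALSE (the TPP forces
  pairwise trivial intersections, `inf_eq_bot_of_tripleProductProperty`, and BCCGU 2017 Thm. 4.2 — tree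
  theorem `BCCGU2017_thm42_holds` — caps pairwise-trivial Young triples at
  `(n!)^{3/2}e^{-(3/2)(cn - d√n log n)}`; `eventually_dlog_le_sqrt` does the bookkeeping).  Witnesses for
  `X`, if any, are non-Young.
* §3 conditional disproofs: `NoThresholdSubsetTriple`, `GlobalBranch ∧ JuntaBranch` (proved glue
  `dichotomyInduction_proof`), a slice-rank saving `SR_F(D_{S_n}) ≤ n!e^{-K√n}` over ANY field (proved
  `stub_transfer`) each give `¬X`; and the no-go `not_sliceRankSaving_of_charZero`: when `n! ≠ 0` in `F` the
  slice rank is the full `n!` (tree theorem `BCCGU2017_corB7_holds`), so the slice-rank route lives in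
  characteristic `p ≤ n` only (line `two-modular-loewy-slice-rank` of crux 8302 works over `𝔽̄₂`).
-/

noncomputable section

set_option linter.dupNamespace false

open scoped BigOperators

namespace Summit.MatrixMultiplication.MatrixMultiplication.Theorems.ThresholdSubsetTriples.Negative

open Summit.MatrixMultiplication.MatrixMultiplication.Theses.SnSubsetDichotomy
open Summit.MatrixMultiplication.MatrixMultiplication.Theorems
open Literature.Combinatorics.Additive
open Literature.Computability.AlgebraicComplexity
open Literature.Barriers.MatrixMultiplication

/-! ## §2 Natural strengthenings refuted -/

/-- `Beats[c, n, S, T, U]`: the volume condition of the crux at scale `c`,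
`(n!)^{3/2}·e^{-c√n} < |S||T||U|` (local notation, no new definition). -/
local notation3 "Beats[" c ", " n ", " S ", " T ", " U "]" =>
  ((Nat.factorial n : ℕ) : ℝ) ^ ((3 : ℝ) / 2) * Real.exp (-(c * Real.sqrt ((n : ℕ) : ℝ))) <
    ((Finset.card S * Finset.card T * Finset.card U : ℕ) : ℝ)

/-- `Young[f]`: the Young subgroup of the labelling `f` as a `Finset` (local notation). -/
local notation3 "Young[" f "]" => Finset.filter (· ∈ youngSubgroup f) Finset.univ

/-- A subgroup, filtered out of `univ`, has `Nat.card` many elements. -/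
theorem card_filter_mem_subgroup {G : Type*} [Group G] [Fintype G] (H : Subgroup G)
    [DecidablePred (· ∈ H)] : (Finset.univ.filter (· ∈ H)).card = Nat.card H := by
  rw [Nat.card_eq_fintype_card,
    Fintype.card_of_subtype (Finset.univ.filter (· ∈ H)) (fun x => by simp)]

/-- Cardinality of a Young subgroup as a `Finset`. -/
theorem card_youngSet {n : ℕ} (f : Fin n → ℕ) :
    (Young[f]).card = Nat.card (youngSubgroup f) :=
  card_filter_mem_subgroup _

/-- Real bookkeeping: `d·log n + 2c/3 ≤ c·√n` for all large `n` (`log = o(√·)`). -/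
theorem eventually_dlog_le_sqrt (c d : ℝ) (hc : 0 < c) :
    ∃ n₀ : ℕ, 2 ≤ n₀ ∧ ∀ n : ℕ, n₀ ≤ n → d * Real.log n + 2 * c / 3 ≤ c * Real.sqrt n := by
  have hε : 0 < c / (2 * (|d| + 1)) := by positivity
  have hlo := (isLittleO_log_rpow_atTop (show (0 : ℝ) < 1 / 2 by norm_num)).bound hε
  obtain ⟨a, ha⟩ := Filter.eventually_atTop.1 hlo
  refine ⟨max 2 ⌈a⌉₊, le_max_left _ _, fun n hn => ?_⟩
  have hn2 : (2 : ℝ) ≤ n := by exact_mod_cast (le_max_left _ _).trans hn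
  have hna : a ≤ n := (Nat.le_ceil a).trans (by exact_mod_cast (le_max_right _ _).trans hn)
  have hb := ha n hna
  rw [Real.norm_eq_abs, Real.norm_eq_abs, abs_of_nonneg (Real.rpow_nonneg (by positivity) _),
    ← Real.sqrt_eq_rpow] at hb
  -- `hb : |log n| ≤ c/(2(|d|+1)) · √n`
  have hsqrt : (4 : ℝ) / 3 ≤ Real.sqrt n := by
    have h2 : Real.sqrt 2 ≤ Real.sqrt n := Real.sqrt_le_sqrt hn2
    have h43 : (4 : ℝ) / 3 ≤ Real.sqrt 2 := by
      rw [Real.le_sqrt (by norm_num) (by norm_num)]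
      norm_num
    linarith
  have h1 : d * Real.log n ≤ |d| * |Real.log n| :=
    calc d * Real.log n ≤ |d * Real.log n| := le_abs_self _
      _ = |d| * |Real.log n| := abs_mul _ _
  have h2 : |d| * |Real.log n| ≤ |d| * (c / (2 * (|d| + 1)) * Real.sqrt n) :=
    mul_le_mul_of_nonneg_left hb (abs_nonneg d)
  have hfrac : |d| * (c / (2 * (|d| + 1))) ≤ c / 2 := by
    have hq : |d| / (|d| + 1) ≤ 1 := div_le_one_of_le₀ (by linarith) (by positivity)
    have hd1 : (|d| + 1) ≠ 0 := by positivity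
    calc |d| * (c / (2 * (|d| + 1))) = c / 2 * (|d| / (|d| + 1)) := by
          field_simp
      _ ≤ c / 2 := mul_le_of_le_one_right (by positivity) hq
  have h3 : |d| * (c / (2 * (|d| + 1)) * Real.sqrt n) ≤ c / 2 * Real.sqrt n := by
    rw [← mul_assoc]
    exact mul_le_mul_of_nonneg_right hfrac (Real.sqrt_nonneg _)
  have h4 : c * (4 / 3) ≤ c * Real.sqrt n := mul_le_mul_of_nonneg_left hsqrt hc.le
  linarith

/-- **`X` restricted to triples of YOUNG SUBGROUPS (the Cohn–Umans "triangle" host class) is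
FALSE** (Blasiak–Church–Cohn–Grochow–Umans 2017, Thm. 4.2, tree theorem
`BCCGU2017_thm42_holds`): with the theorem's constants `c, d`, a Young TPP triple has pairwise trivial
intersections (`inf_eq_bot_of_tripleProductProperty`), hence `e^{cn-d√n log n} ≤ n!/V^{2/3}`, i.e.
`log V ≤ (3/2)(log n! - cn + d√n log n)`, while the threshold at scale `c` says
`log V > (3/2) log n! - c√n`; for `n` with `d log n + 2c/3 ≤ c√n` these are incompatible.  So the
counterexample family `X` asks for is NOT made of Young subgroups. -/
theorem not_thresholdYoungTriples :
    ¬ (∀ c : ℝ, 0 < c → ∀ n₀ : ℕ, ∃ n ≥ n₀, ∃ f₁ f₂ f₃ : Fin n → ℕ,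
      TripleProductProperty Young[f₁] Young[f₂] Young[f₃] ∧
        Beats[c, n, Young[f₁], Young[f₂], Young[f₃]]) := by
  intro h
  obtain ⟨c, d, hc, _, H⟩ := BCCGU2017_thm42_holds
  obtain ⟨n₀, hn₀2, hev⟩ := eventually_dlog_le_sqrt c d hc
  obtain ⟨n, hn, f₁, f₂, f₃, hTPP, hlt⟩ := h c hc n₀
  have hn2 : 2 ≤ n := hn₀2.trans hn
  obtain ⟨h12, h23, h13⟩ :=
    inf_eq_bot_of_tripleProductProperty (youngSubgroup f₁) (youngSubgroup f₂) (youngSubgroup f₃) hTPP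
  have h42 := H n hn2 f₁ f₂ f₃ h12 h23 h13
  rw [card_youngSet, card_youngSet, card_youngSet] at hlt
  set V : ℝ := ((Nat.card (youngSubgroup f₁) * Nat.card (youngSubgroup f₂) *
    Nat.card (youngSubgroup f₃) : ℕ) : ℝ) with hV
  set F : ℝ := (n.factorial : ℝ) with hF
  set s : ℝ := Real.sqrt n with hs
  have hF0 : 0 < F := by rw [hF]; exact_mod_cast n.factorial_pos
  have hM0 : 0 < F ^ ((3 : ℝ) / 2) * Real.exp (-(c * s)) := by positivity
  have hV0 : 0 < V := hM0.trans hlt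
  -- Thm 4.2 in logarithms: `c n - d s log n ≤ log F - (2/3) log V`
  have hlog42 : c * n - d * s * Real.log n ≤ Real.log F - 2 / 3 * Real.log V := by
    have h1 : Real.log (Real.exp (c * n - d * s * Real.log n)) ≤ Real.log (F / V ^ (2 / 3 : ℝ)) :=
      Real.log_le_log (Real.exp_pos _) h42
    rw [Real.log_exp, Real.log_div hF0.ne' (Real.rpow_pos_of_pos hV0 _).ne', Real.log_rpow hV0] at h1
    linarith
  -- the threshold in logarithms: `(3/2) log F - c s < log V`
  have hlogV : 3 / 2 * Real.log F + -(c * s) < Real.log V := by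
    have h1 : Real.log (F ^ ((3 : ℝ) / 2) * Real.exp (-(c * s))) < Real.log V := Real.log_lt_log hM0 hlt
    rw [Real.log_mul (Real.rpow_pos_of_pos hF0 _).ne' (Real.exp_pos _).ne', Real.log_rpow hF0,
      Real.log_exp] at h1
    linarith
  have hkey : c * n - d * s * Real.log n < 2 * c / 3 * s := by linarith
  -- the eventual inequality, multiplied by `s = √n`
  have hss : s * s = n := by rw [hs]; exact Real.mul_self_sqrt (Nat.cast_nonneg n)
  have hs0 : 0 ≤ s := Real.sqrt_nonneg _
  have hev' : (d * Real.log n + 2 * c / 3) * s ≤ c * n := by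
    calc (d * Real.log n + 2 * c / 3) * s ≤ (c * Real.sqrt n) * s :=
          mul_le_mul_of_nonneg_right (hev n hn) hs0
      _ = c * (s * s) := by rw [hs]; ring
      _ = c * n := by rw [hss]
  nlinarith [hev', hkey]

/-! ## §3 What would kill `X`: conditional disproofs, and where they cannot come from -/

/-- A proof of the negative crux (stmt-8302) refutes `X`. -/
theorem not_thresholdSubsetTriples_of_noThreshold (h : NoThresholdSubsetTriple) :
    ¬ ThresholdSubsetTriples :=
  fun hX => not_noThreshold_of_threshold hX h

/-- The route's global/junta dichotomy refutes `X` (through the PROVED glue `dichotomyInduction_proof`);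
both branches are open cruxes (8303, 8304). -/
theorem not_thresholdSubsetTriples_of_branches (hG : GlobalBranch) (hJ : JuntaBranch) :
    ¬ ThresholdSubsetTriples :=
  not_thresholdSubsetTriples_of_noThreshold (dichotomyInduction_proof hG hJ)

/-- The slice-rank saving `C⁺` for the group tensor `D_{S_n}(x,y,z) = [xyz = 1]` over a field `F`:
`slice-rank ≤ n!·e^{-K√n}` eventually, for some `K > 0` (BCCGU 2017 §6 conjecture, weak form;
local notation `SliceRankSaving[F]`). -/
local notation3 "SliceRankSaving[" F "]" =>
  ∃ K : ℝ, 0 < K ∧ ∃ n₀ : ℕ, ∀ n ≥ n₀,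
    (sliceRank (mulGroupTensor F (Equiv.Perm (Fin n))) : ℝ) ≤
      (n.factorial : ℝ) * Real.exp (-(K * Real.sqrt (n : ℝ)))

/-- A slice-rank saving over ANY field refutes `X` (the PROVED transfer `stub_transfer` of line
`two-modular-loewy-slice-rank`: packing + heredity + `N² ≤ slice-rank`, BCCGU 2017 Prop. B.6). -/
theorem not_thresholdSubsetTriples_of_sliceRankSaving (F : Type) [Field F] (h : SliceRankSaving[F]) :
    ¬ ThresholdSubsetTriples :=
  not_thresholdSubsetTriples_of_noThreshold (stub_transfer F h)

/-- In a field in which `n! ≠ 0` the group tensor of `S_n` has FULL slice rank `n!`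
(BCCGU 2017 Cor. B.7, tree theorem `BCCGU2017_corB7_holds`, all-fields form). -/
theorem sliceRank_perm_eq_factorial (F : Type) [Field F] {n : ℕ} (hchar : (n.factorial : F) ≠ 0) :
    sliceRank (mulGroupTensor F (Equiv.Perm (Fin n))) = n.factorial := by
  have hcard : Fintype.card (Equiv.Perm (Fin n)) = n.factorial := by
    rw [Fintype.card_perm, Fintype.card_fin]
  have h := BCCGU2017_corB7_holds.of_field F (Equiv.Perm (Fin n)) (by rwa [hcard])
  rwa [hcard] at h

/-- **No-go: the slice-rank route is modular.**  Over a field of characteristic `0` there is no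
slice-rank saving at all (full slice rank `n!` at every `n ≥ 1`), so `not_thresholdSubsetTriples_of_
sliceRankSaving` can only ever be fed in characteristic `p ≤ n` (for fixed `p > 0` and `n < p` the slice
rank is again full, `sliceRank_perm_eq_factorial`). -/
theorem not_sliceRankSaving_of_charZero (F : Type) [Field F] [CharZero F] :
    ¬ SliceRankSaving[F] := by
  rintro ⟨K, hK, n₀, h⟩
  set m : ℕ := max n₀ 1 with hm
  have hn := h m (le_max_left _ _)
  rw [sliceRank_perm_eq_factorial F (by exact_mod_cast (Nat.factorial_pos m).ne')] at hn
  have hF : (0 : ℝ) < (m.factorial : ℝ) := by exact_mod_cast Nat.factorial_pos m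
  have hm1 : (0 : ℝ) < (m : ℝ) := by exact_mod_cast (le_max_right n₀ 1 : 1 ≤ m)
  have hexp : Real.exp (-(K * Real.sqrt (m : ℝ))) < 1 := by
    rw [Real.exp_lt_one_iff, neg_lt_zero]
    exact mul_pos hK (Real.sqrt_pos.2 hm1)
  have hlt : (m.factorial : ℝ) * Real.exp (-(K * Real.sqrt (m : ℝ))) < m.factorial :=
    calc (m.factorial : ℝ) * Real.exp (-(K * Real.sqrt (m : ℝ))) < (m.factorial : ℝ) * 1 :=
          mul_lt_mul_of_pos_left hexp hF
      _ = m.factorial := mul_one _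
  linarith


end Summit.MatrixMultiplication.MatrixMultiplication.Theorems.ThresholdSubsetTriples.Negative

end
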